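import Literature.Computability.AlgebraicComplexity.SymmetricArithCircuit
import Mathlib.Data.Fintype.Sum
import Mathlib.Data.Fintype.Fin
import Mathlib.Tactic.FinCases
import HarnessLib

/-!
# Symmetric circuits: linear combinations of two symmetric circuits (the circuit)

Topic `Computability/AlgebraicComplexity`, namespace `Literature.Computability.AlgebraicComplexity`.

A closure property of Dawar–Wilsenach symmetric arithmetic circuits
(`SymmetricArithCircuit.lean`: `LabelledArithCircuit` = Def. 2.2, `IsAutomorphismExtending` =
Def. 3.6, `IsSymmetric` = Def. 3.7 of A. Dawar, G. Wilsenach, *Symmetric Arithmetic Circuits*,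
Theory of Computing 21 (2025)): from `Γ`-symmetric single-output circuits `C₁`, `C₂` over the
same constants `K` and variables `X` and two constants `a, b ∈ K` one gets a `Γ`-symmetric
single-output circuit computing `a · C₁ + b · C₂` with at most `|G₁| + |G₂| + 8` gates. This file
builds the post-composition gadget (`LabelledArithCircuit.LinComb.circuit`); its semantics,
symmetry, size and the packaged statement `LabelledArithCircuit.IsSymmetric.exists_linComb`
(which first pairs `C₁`, `C₂` by `SymmetricCircuitPairing.lean`) are in
`SymmetricCircuitLinCombSymmetry.lean`.

The gadget post-composes ANY labelled circuit `P` with two designated output indices `y₁, y₂`: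
gates (`LinCombGate`) are the old gates of `P`, NEW constant gates only for those of `a, b` that
are not already the label of a (constant) gate of `P` (Def. 2.2 demands injective labels on input
gates, so existing constant gates are reused, `csrc`), two unary addition gates `sa`, `sb` over
the sources of `a`, `b` (values `a`, `b`; being fresh they never coincide with an old output gate,
which keeps the products below binary), two multiplication gates `ma = sa × out_{y₁}`,
`mb = sb × out_{y₂}` and the output `out = ma + mb`. Everything is folklore and proved; nothing
here is a named fact.
-/

noncomputable section

open scoped Classical

namespace Literature.Computability.AlgebraicComplexity

open MvPolynomial

universe u v w z

/-! ### Gates -/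

/-- Gates of the linear-combination circuit over a circuit with gate type `G`: the old gates, new
constant gates (`NC`), the unary sums `sa`, `sb` (values `a`, `b`), the products `ma = sa × out₁`,
`mb = sb × out₂` and the output `out = ma + mb`. [cite: DawarWilsenach2025, Def. 2.2] -/
inductive LinCombGate (G : Type w) (NC : Type u) : Type (max u w)
  | old (g : G) : LinCombGate G NC
  | ncst (c : NC) : LinCombGate G NC
  | sa : LinCombGate G NC
  | sb : LinCombGate G NC
  | ma : LinCombGate G NC
  | mb : LinCombGate G NC
  | out : LinCombGate G NC

namespace LinCombGate

variable {G : Type w} {NC : Type u}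

/-- The gates as a sum type (for counting). [cite: DawarWilsenach2025, Def. 2.2 (size)] -/
def equivSum : LinCombGate G NC ≃ G ⊕ NC ⊕ Fin 5 where
  toFun
    | old g => Sum.inl g
    | ncst c => Sum.inr (Sum.inl c)
    | sa => Sum.inr (Sum.inr 0)
    | sb => Sum.inr (Sum.inr 1)
    | ma => Sum.inr (Sum.inr 2)
    | mb => Sum.inr (Sum.inr 3)
    | out => Sum.inr (Sum.inr 4)
  invFun
    | Sum.inl g => old g
    | Sum.inr (Sum.inl c) => ncst c
    | Sum.inr (Sum.inr 0) => sa
    | Sum.inr (Sum.inr 1) => sb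
    | Sum.inr (Sum.inr 2) => ma
    | Sum.inr (Sum.inr 3) => mb
    | Sum.inr (Sum.inr 4) => out
  left_inv g := by cases g <;> rfl
  right_inv t := by
    rcases t with g | c | k <;> [rfl; rfl; (fin_cases k <;> rfl)]

/-- Finitely many gates over finitely many old gates and constants. [cite: DawarWilsenach2025, Def. 2.2 (size)] -/
instance instFintype [Fintype G] [Fintype NC] : Fintype (LinCombGate G NC) :=
  Fintype.ofEquiv _ equivSum.symm

/-- `old` is injective. [cite: DawarWilsenach2025, Def. 2.2] -/
theorem old_injective : Function.Injective (old : G → LinCombGate G NC) := by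
  intro a b h; cases h; rfl

/-- `old` as an embedding (to map children sets). [cite: DawarWilsenach2025, Def. 2.2] -/
def oldEmb : G ↪ LinCombGate G NC := ⟨old, old_injective⟩

/-- `oldEmb` is `old`. [cite: DawarWilsenach2025, Def. 2.2] -/
@[simp] theorem oldEmb_apply (g : G) : (oldEmb : G ↪ LinCombGate G NC) g = old g := rfl

/-- Relabelling the old gates by `π`, fixing the new gates. [cite: DawarWilsenach2025, Def. 3.6] -/
def perm (π : Equiv.Perm G) : Equiv.Perm (LinCombGate G NC) where
  toFun
    | old g => old (π g)
    | ncst c => ncst c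
    | sa => sa
    | sb => sb
    | ma => ma
    | mb => mb
    | out => out
  invFun
    | old g => old (π.symm g)
    | ncst c => ncst c
    | sa => sa
    | sb => sb
    | ma => ma
    | mb => mb
    | out => out
  left_inv g := by cases g <;> simp
  right_inv g := by cases g <;> simp

end LinCombGate

/-! ### The construction -/

namespace LabelledArithCircuit

namespace LinComb

variable {K : Type u} {X : Type v} {Y : Type z} {G : Type w}
  (P : LabelledArithCircuit K X Y G) (y₁ y₂ : Y) (a b : K)

/-- The constants used by the linear-combination circuit: `a`, `b`. [cite: DawarWilsenach2025, Def. 2.2] -/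
def cset : Finset K := {a, b}

/-- `a, b ∈ cset a b`. [cite: DawarWilsenach2025, Def. 2.2] -/
theorem mem_cset : a ∈ cset a b ∧ b ∈ cset a b := by simp [cset]

/-- The constants of `cset a b` with no constant gate in `P`. [cite: DawarWilsenach2025, Def. 2.2] -/
def NC : Type u := {c : K // c ∈ cset a b ∧ ∀ g, P.label g ≠ .const c}

/-- `NC` is finite (a subset of `cset a b`). [cite: DawarWilsenach2025, Def. 2.2 (size)] -/
instance instFintypeNC : Fintype (NC P a b) :=
  Fintype.subtype ((cset a b).filter fun c => ∀ g, P.label g ≠ .const c) (fun c => by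
    simp [Finset.mem_filter])

/-- The gate type of the linear-combination circuit. [cite: DawarWilsenach2025, Def. 2.2] -/
abbrev Gate : Type (max u w) := LinCombGate G (NC P a b)

variable {P a b}

/-- The gate sourcing the constant `c ∈ cset a b`: the old gate labelled `c` if there is one,
else the new one. [cite: DawarWilsenach2025, Def. 2.2] -/
def csrc (c : K) (hc : c ∈ cset a b) : Gate P a b :=
  if h : ∃ g, P.label g = .const c then .old h.choose else .ncst ⟨c, hc, not_exists.mp h⟩

variable (P a b)

/-- Children in the linear-combination circuit (module docstring). [cite: DawarWilsenach2025, Def. 2.2] -/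
def children : Gate P a b → Finset (Gate P a b)
  | .old g => (P.children g).map LinCombGate.oldEmb
  | .ncst _ => ∅
  | .sa => {csrc a (mem_cset a b).1}
  | .sb => {csrc b (mem_cset a b).2}
  | .ma => {LinCombGate.sa, LinCombGate.old (P.output y₁)}
  | .mb => {LinCombGate.sb, LinCombGate.old (P.output y₂)}
  | .out => {LinCombGate.ma, LinCombGate.mb}

/-- Labels in the linear-combination circuit. [cite: DawarWilsenach2025, Def. 2.2] -/
def label : Gate P a b → CircuitLabel K X
  | .old g => P.label g
  | .ncst c => .const c.1
  | .sa => .add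
  | .sb => .add
  | .ma => .mul
  | .mb => .mul
  | .out => .add

variable {P y₁ y₂ a b}

/-- `csrc c` is labelled `c`. [cite: DawarWilsenach2025, Def. 2.2] -/
theorem label_csrc (c : K) (hc : c ∈ cset a b) : label P a b (csrc c hc) = .const c := by
  unfold csrc
  split_ifs with h
  · exact h.choose_spec
  · rfl

/-- `csrc c` is an input gate. [cite: DawarWilsenach2025, Def. 2.2] -/
theorem children_csrc (c : K) (hc : c ∈ cset a b) : children P y₁ y₂ a b (csrc c hc) = ∅ := by
  unfold csrc
  split_ifs with h
  · have h1 : (P.label h.choose).IsInput := by rw [h.choose_spec]; trivial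
    simp [children, (P.isInput_iff _).1 h1]
  · rfl

/-! #### Acyclicity -/

/-- Old gates are accessible (acyclicity of `P`). [cite: DawarWilsenach2025, Def. 2.2] -/
theorem acc_old (g : G) : Acc (fun s t : Gate P a b => s ∈ children P y₁ y₂ a b t) (.old g) := by
  induction g using P.wf.induction with
  | h g ih =>
    refine Acc.intro _ fun s hs => ?_
    simp only [children, Finset.mem_map, LinCombGate.oldEmb_apply] at hs
    obtain ⟨h, hh, rfl⟩ := hs
    exact ih h hh

/-- Gates without children are accessible. [cite: DawarWilsenach2025, Def. 2.2] -/
theorem acc_of_children_eq_empty {s : Gate P a b} (h : children P y₁ y₂ a b s = ∅) :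
    Acc (fun s t : Gate P a b => s ∈ children P y₁ y₂ a b t) s :=
  Acc.intro _ fun t ht => by simp [h] at ht

/-- `sa` is accessible. [cite: DawarWilsenach2025, Def. 2.2] -/
theorem acc_sa : Acc (fun s t : Gate P a b => s ∈ children P y₁ y₂ a b t) .sa := by
  refine Acc.intro _ fun s hs => ?_
  simp only [children, Finset.mem_singleton] at hs
  rw [hs]
  exact acc_of_children_eq_empty (children_csrc _ _)

/-- `sb` is accessible. [cite: DawarWilsenach2025, Def. 2.2] -/
theorem acc_sb : Acc (fun s t : Gate P a b => s ∈ children P y₁ y₂ a b t) .sb := by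
  refine Acc.intro _ fun s hs => ?_
  simp only [children, Finset.mem_singleton] at hs
  rw [hs]
  exact acc_of_children_eq_empty (children_csrc _ _)

/-- `ma` is accessible. [cite: DawarWilsenach2025, Def. 2.2] -/
theorem acc_ma : Acc (fun s t : Gate P a b => s ∈ children P y₁ y₂ a b t) .ma := by
  refine Acc.intro _ fun s hs => ?_
  simp only [children, Finset.mem_insert, Finset.mem_singleton] at hs
  rcases hs with rfl | rfl
  · exact acc_sa
  · exact acc_old _

/-- `mb` is accessible. [cite: DawarWilsenach2025, Def. 2.2] -/
theorem acc_mb : Acc (fun s t : Gate P a b => s ∈ children P y₁ y₂ a b t) .mb := by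
  refine Acc.intro _ fun s hs => ?_
  simp only [children, Finset.mem_insert, Finset.mem_singleton] at hs
  rcases hs with rfl | rfl
  · exact acc_sb
  · exact acc_old _

/-- `out` is accessible. [cite: DawarWilsenach2025, Def. 2.2] -/
theorem acc_out : Acc (fun s t : Gate P a b => s ∈ children P y₁ y₂ a b t) .out := by
  refine Acc.intro _ fun s hs => ?_
  simp only [children, Finset.mem_insert, Finset.mem_singleton] at hs
  rcases hs with rfl | rfl
  · exact acc_ma
  · exact acc_mb

/-- The child relation of the linear-combination circuit is well founded. [cite: DawarWilsenach2025, Def. 2.2] -/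
theorem wf : WellFounded fun s t : Gate P a b => s ∈ children P y₁ y₂ a b t :=
  ⟨fun s => by
    cases s with
    | old g => exact acc_old g
    | ncst c => exact acc_of_children_eq_empty rfl
    | sa => exact acc_sa
    | sb => exact acc_sb
    | ma => exact acc_ma
    | mb => exact acc_mb
    | out => exact acc_out⟩

/-! #### The labelled circuit -/

/-- Input labels exactly at the gates without children. [cite: DawarWilsenach2025, Def. 2.2] -/
theorem isInput_iff (s : Gate P a b) : (label P a b s).IsInput ↔ children P y₁ y₂ a b s = ∅ := by
  cases s with
  | old g => simp only [label, children, Finset.map_eq_empty]; exact P.isInput_iff g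
  | ncst c => simp [label, children]
  | sa => simp [label, children, CircuitLabel.IsInput]
  | sb => simp [label, children, CircuitLabel.IsInput]
  | ma => simp [label, children, CircuitLabel.IsInput]
  | mb => simp [label, children, CircuitLabel.IsInput]
  | out => simp [label, children, CircuitLabel.IsInput]

/-- Labels are injective on input gates. [cite: DawarWilsenach2025, Def. 2.2] -/
theorem eq_of_label_eq (s t : Gate P a b) (hs : (label P a b s).IsInput)
    (hst : label P a b s = label P a b t) : s = t := by
  cases s with
  | old g =>
    change (P.label g).IsInput at hs
    cases t with
    | old g' => exact congrArg LinCombGate.old (P.eq_of_label_eq g g' hs hst)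
    | ncst c => exact absurd hst (c.2.2 g)
    | _ => simp only [label] at hst; rw [hst] at hs; exact absurd hs (by simp)
  | ncst c =>
    cases t with
    | old g => exact absurd hst.symm (c.2.2 g)
    | ncst c' =>
      simp only [label, CircuitLabel.const.injEq] at hst
      exact congrArg LinCombGate.ncst (Subtype.ext hst)
    | _ => simp [label] at hst
  | _ => exact absurd hs (by simp [label])

variable (P y₁ y₂ a b)

/-- **The linear-combination circuit** over `P` (module docstring): on top of `P`, the gates
computing `a`, `b`, `a × out_{y₁}`, `b × out_{y₂}` and the single output `a·out_{y₁} + b·out_{y₂}`.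
[cite: DawarWilsenach2025, Def. 2.2] -/
def circuit : LabelledArithCircuit K X Unit (Gate P a b) where
  children := children P y₁ y₂ a b
  label := label P a b
  output := fun _ => .out
  wf := wf
  isInput_iff := isInput_iff
  eq_of_label_eq := eq_of_label_eq
  output_injective := fun s t _ => Subsingleton.elim s t

end LinComb

end LabelledArithCircuit

end Literature.Computability.AlgebraicComplexity

end
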